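import Summits.BirchSwinnertonDyer.Rank1Residual.F1Sign2.MinusHalfSumParityAtTwo
import Literature.NumberTheory.EllipticCurves.PAdicLFunctionMinusDistributionProofs
import Literature.NumberTheory.EllipticCurves.PAdicLFunctionMinusIntegralityProofs
import Mathlib.NumberTheory.LegendreSymbol.GaussEisensteinLemmas
import HarnessLib

/-!
# Cell `bsd-f1-sign2`, AN-33b/c PROOFS: the Hecke step for the minus half-sums at every odd level and the proportionality law mod 2 — KERNEL-CHECKED (-an g16, Sketch_v26 §5; TURNKEY D-an-77)

TYPER FILING (cell `bsd-f1-sign2`, seat `-ty` g10): §5 of `MEMO-an-data/g16/Sketch_v26.lean` 365abf27ff2d3723 VERBATIM (= the standalone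
`g16/AN33bc_Proofs_dev2.lean` 6cf8b3fdb7ff84ee proofs; -an: farm rc 0 · 0 err · 0 warn · 0 sorry, audit closed=true), in the namespace of and importing
the statement file `F1Sign2/MinusHalfSumParityAtTwo.lean`.  Ends in **`minusHalfSumHeckeStepModTwo_holds : MinusHalfSumHeckeStepModTwo`** (AN-33b,
every odd level `m`) and **`minusHalfSumProportionalityModTwo_holds : MinusHalfSumProportionalityModTwo`** (AN-33c).  Inputs (all tree or Mathlib):
the Hecke relation `intCast_mul_ratMinusSymbol` (Mazur–Tate–Teitelbaum §I.4), `1`-periodicity and oddness of `[·]⁻` (`ratMinusSymbol_add_intCast`,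
`ratMinusSymbol_neg`), rationality `ratCast_ratMinusSymbol` (Manin–Drinfeld, proved in the tree), and the half-system permutation
`sum_Icc_natAbs_valMinAbs_mul_eq` proved below from `ZMod.natCast_natAbs_valMinAbs` (Mathlib has the prime case
`ZMod.Ico_map_valMinAbs_natAbs_eq_Ico_map_id`, Gauss-lemma style).  Helper identities: `sum_weight_mul_ratMinusSymbol`
(`Σ_{n<M} c_n[n/M]⁻ = Σ_{k≤H}(c_k − c_{M−k})[k/M]⁻`), `exists_int_doubleSum_eq_sub` (the Hecke double sum ≡ `F_{qm} − F_q` mod `2u`).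
Typer edits = this header and the imports; proofs verbatim.  Nothing here proves BSD.
[cite: MazurTateTeitelbaum1986, §I.4]
-/

set_option autoImplicit false

noncomputable section

open scoped MatrixGroups ModularForm

open CongruenceSubgroup Literature.NumberTheory.EllipticCurves Literature.NumberTheory.EllipticCurves.ModularForms

namespace Summit.BirchSwinnertonDyer.Rank1Residual.F1Sign2.ANg16

/-! ### §5 PROOFS (v26, g16 addendum): the Hecke step AN-33b (every odd level `m`) and the proportionality law AN-33c,
KERNEL-CHECKED from the tree's Hecke relation `intCast_mul_ratMinusSymbol` (MTT §I.4), the `1`-periodicity / oddness of `[·]⁻`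
(`ratMinusSymbol_add_intCast`, `ratMinusSymbol_neg`), rationality `ratCast_ratMinusSymbol`, and the half-system permutation
`sum_Icc_natAbs_valMinAbs_mul_eq` (for a unit `a` of `ZMod m`, `m = 2h+1`, `k ↦ |a·k|` permutes `[1, h]`; Mathlib has the prime case
`ZMod.Ico_map_valMinAbs_natAbs_eq_Ico_map_id`, the odd-modulus case is proved here from `ZMod.natCast_natAbs_valMinAbs`).  Route of proof:
sum the Hecke relation `a_q [k/m]⁻ = Σ_{j<q} [(k + jm)/(qm)]⁻ + [qk/m]⁻` over `1 ≤ k ≤ h = (m−1)/2`; the double sum is the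
indicator-weighted full-range sum at level `qm`, which the reflection identity `Σ_{n<M} c_n [n/M]⁻ = Σ_{k≤H} (c_k − c_{M−k}) [k/M]⁻`
reduces `mod 2u` to `F_{qm} − F_q` (weights `±1` off the multiples of `m`, `0` on them); the last sum is `≡ F_m` by the permutation. -/

section HalfSumProofs

open Finset

variable {N : ℕ} [NeZero N] (f : CuspForm (Gamma0 N) 2)

/-- `[(M − k)/M]⁻ = −[k/M]⁻` (oddness + `1`-periodicity of the minus symbol). -/
theorem ratMinusSymbol_sub_div {M k : ℕ} (hM : M ≠ 0) (hk : k ≤ M) :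
    ratMinusSymbol f (((M - k : ℕ) : ℚ) / (M : ℚ)) = - ratMinusSymbol f ((k : ℚ) / (M : ℚ)) := by
  have hM' : (M : ℚ) ≠ 0 := Nat.cast_ne_zero.mpr hM
  have e : ((M - k : ℕ) : ℚ) / (M : ℚ) = -((k : ℚ) / (M : ℚ)) + 1 := by
    rw [Nat.cast_sub hk]; field_simp; ring
  have h1 := ratMinusSymbol_add_intCast f (-((k : ℚ) / (M : ℚ))) 1
  push_cast at h1
  rw [e, h1, ratMinusSymbol_neg]

/-- Reflection pairing on `[1, 2H]`: `∑_{n=1}^{2H} a n = ∑_{k=1}^{H} a k + ∑_{k=1}^{H} a (2H+1−k)`. -/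
theorem sum_Icc_twice_eq_add_reflect (a : ℕ → ℚ) (H : ℕ) :
    ∑ n ∈ Icc 1 (2 * H), a n = ∑ k ∈ Icc 1 H, a k + ∑ k ∈ Icc 1 H, a (2 * H + 1 - k) := by
  have hsplit : Icc 1 (2 * H) = Icc 1 H ∪ Icc (H + 1) (2 * H) := by
    ext n; simp only [mem_union, mem_Icc]; omega
  have hdisj : Disjoint (Icc 1 H) (Icc (H + 1) (2 * H)) := by
    rw [disjoint_left]; intro n h1 h2; rw [mem_Icc] at h1 h2; omega
  rw [hsplit, sum_union hdisj]
  congr 1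
  refine sum_nbij' (fun n => 2 * H + 1 - n) (fun k => 2 * H + 1 - k) ?_ ?_ ?_ ?_ ?_
  · intro n hn; rw [mem_Icc] at hn ⊢; omega
  · intro k hk; rw [mem_Icc] at hk ⊢; omega
  · intro n hn; rw [mem_Icc] at hn; omega
  · intro k hk; rw [mem_Icc] at hk; omega
  · intro n hn; rw [mem_Icc] at hn; congr 1; omega

/-- The weighted pairing identity: `∑_{n=1}^{2H} c_n [n/M]⁻ = ∑_{k=1}^{H} (c_k − c_{M−k}) [k/M]⁻`, `M = 2H+1`. -/
theorem sum_weight_mul_ratMinusSymbol (c : ℕ → ℤ) (H : ℕ) :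
    ∑ n ∈ Icc 1 (2 * H), (c n : ℚ) * ratMinusSymbol f ((n : ℚ) / ((2 * H + 1 : ℕ) : ℚ)) =
      ∑ k ∈ Icc 1 H, ((c k - c (2 * H + 1 - k) : ℤ) : ℚ) * ratMinusSymbol f ((k : ℚ) / ((2 * H + 1 : ℕ) : ℚ)) := by
  rw [sum_Icc_twice_eq_add_reflect, ← sum_add_distrib]
  refine sum_congr rfl fun k hk => ?_
  rw [mem_Icc] at hk
  have hr := ratMinusSymbol_sub_div f (M := 2 * H + 1) (k := k) (by omega) (by omega)
  rw [hr]
  push_cast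
  ring

/-- Termwise congruences `mod 2u` add up. -/
theorem exists_int_sum_sub_sum {u : ℚ} (s : Finset ℕ) (a b : ℕ → ℚ)
    (h : ∀ k ∈ s, ∃ z : ℤ, a k - b k = 2 * z * u) :
    ∃ z : ℤ, ∑ k ∈ s, a k - ∑ k ∈ s, b k = 2 * z * u := by
  choose! z hz using h
  refine ⟨∑ k ∈ s, z k, ?_⟩
  rw [← sum_sub_distrib, sum_congr rfl hz]
  push_cast
  rw [mul_sum, sum_mul]

/-- `(M − k) mod p = p − (k mod p)` when `p ∣ M`, `k ≤ M`, `p ∤ k`. -/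
theorem sub_mod_eq_of_dvd {p M k : ℕ} (hp : 0 < p) (hM : p ∣ M) (hk : k ≤ M) (hpk : ¬ p ∣ k) :
    (M - k) % p = p - k % p := by
  obtain ⟨c, rfl⟩ := hM
  have hr0 : 0 < k % p := Nat.pos_of_ne_zero fun h0 => hpk (Nat.dvd_of_mod_eq_zero h0)
  have hrp : k % p < p := Nat.mod_lt k hp
  have hk' : p * (k / p) + k % p = k := Nat.div_add_mod k p
  have htc : k / p < c := by
    by_contra hle
    have h5 : p * c ≤ p * (k / p) := Nat.mul_le_mul_left p (by omega)
    omega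
  have hsplit : p * c - k = (p - k % p) + p * (c - k / p - 1) := by
    have e : p * (c - k / p - 1) + p * (k / p) + p = p * c := by
      have : (c - k / p - 1) + k / p + 1 = c := by omega
      calc p * (c - k / p - 1) + p * (k / p) + p = p * ((c - k / p - 1) + k / p + 1) := by ring
        _ = p * c := by rw [this]
    omega
  rw [hsplit, Nat.add_mul_mod_self_left, Nat.mod_eq_of_lt (by omega)]

/-- LEMMA C: the double sum of the Hecke relation equals `F_{qp} − F_q (mod 2u)` (`p = 2h+1`, `q = 2h'+1`, `qp = 2H+1`). -/
theorem exists_int_doubleSum_eq_sub {u : ℚ} (hu : IsMinusSymbolUnit f u) (p q H h h' : ℕ)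
    (hp : p = 2 * h + 1) (hq : q = 2 * h' + 1) (hM : q * p = 2 * H + 1) :
    ∃ z : ℤ, ∑ k ∈ Icc 1 h, ∑ j ∈ range q, ratMinusSymbol f (((k + j * p : ℕ) : ℚ) / ((2 * H + 1 : ℕ) : ℚ)) =
      ∑ k ∈ Icc 1 H, ratMinusSymbol f ((k : ℚ) / ((2 * H + 1 : ℕ) : ℚ))
        - ∑ i ∈ Icc 1 h', ratMinusSymbol f ((i : ℚ) / (q : ℚ)) + 2 * z * u := by
  have hp0 : 0 < p := by omega
  have hHp : H = p * h' + h := by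
    have : 2 * H + 1 = 2 * (p * h' + h) + 1 := by rw [← hM, hp, hq]; ring
    omega
  have hpM : p ∣ 2 * H + 1 := by rw [← hM]; exact Dvd.intro_left q rfl
  -- (i) the double sum as a filtered sum over [1, 2H]
  have h1 : ∑ k ∈ Icc 1 h, ∑ j ∈ range q, ratMinusSymbol f (((k + j * p : ℕ) : ℚ) / ((2 * H + 1 : ℕ) : ℚ)) =
      ∑ n ∈ (Icc 1 (2 * H)).filter (fun n => n % p ∈ Icc 1 h), ratMinusSymbol f ((n : ℚ) / ((2 * H + 1 : ℕ) : ℚ)) := by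
    rw [← sum_product']
    refine sum_nbij' (fun x => x.1 + x.2 * p) (fun n => (n % p, n / p)) ?_ ?_ ?_ ?_ ?_
    · rintro ⟨k, j⟩ hx
      rw [mem_product, mem_Icc, mem_range] at hx
      obtain ⟨⟨hk1, hkh⟩, hjq⟩ := hx
      have hkp : k < p := by omega
      dsimp only
      rw [mem_filter, mem_Icc, Nat.add_mul_mod_self_right, Nat.mod_eq_of_lt hkp, mem_Icc]
      refine ⟨⟨by omega, ?_⟩, hk1, hkh⟩
      have h2 : j * p ≤ (q - 1) * p := Nat.mul_le_mul_right p (by omega)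
      have e : (q - 1) * p + p = q * p := by
        have : q - 1 = 2 * h' := by omega
        rw [this, hq]; ring
      omega
    · intro n hn
      rw [mem_filter, mem_Icc] at hn
      obtain ⟨⟨hn1, hn2⟩, hnP⟩ := hn
      rw [mem_product, mem_range]
      refine ⟨hnP, ?_⟩
      rw [Nat.div_lt_iff_lt_mul hp0]; omega
    · rintro ⟨k, j⟩ hx
      rw [mem_product, mem_Icc, mem_range] at hx
      obtain ⟨⟨hk1, hkh⟩, hjq⟩ := hx
      have hkp : k < p := by omega
      refine Prod.ext ?_ ?_
      · show (k + j * p) % p = k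
        rw [Nat.add_mul_mod_self_right, Nat.mod_eq_of_lt hkp]
      · show (k + j * p) / p = j
        rw [Nat.add_mul_div_right _ _ hp0, Nat.div_eq_of_lt hkp, zero_add]
    · intro n hn
      exact Nat.mod_add_div' n p
    · rintro ⟨k, j⟩ hx
      rfl
  -- (ii) filtered sum = weighted sum, then reflect
  have h2 : ∑ n ∈ (Icc 1 (2 * H)).filter (fun n => n % p ∈ Icc 1 h), ratMinusSymbol f ((n : ℚ) / ((2 * H + 1 : ℕ) : ℚ)) =
      ∑ n ∈ Icc 1 (2 * H), ((if n % p ∈ Icc 1 h then (1 : ℤ) else 0 : ℤ) : ℚ) *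
        ratMinusSymbol f ((n : ℚ) / ((2 * H + 1 : ℕ) : ℚ)) := by
    rw [sum_filter]
    refine sum_congr rfl fun n hn => ?_
    split_ifs <;> simp
  have h3 := sum_weight_mul_ratMinusSymbol f (fun n => if n % p ∈ Icc 1 h then (1 : ℤ) else 0) H
  -- (iii) termwise congruence with `b k := if p ∣ k then 0 else [k/M]⁻`
  have h4 : ∃ z : ℤ, ∑ k ∈ Icc 1 H, (((if k % p ∈ Icc 1 h then (1 : ℤ) else 0) -
        (if (2 * H + 1 - k) % p ∈ Icc 1 h then (1 : ℤ) else 0) : ℤ) : ℚ) *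
        ratMinusSymbol f ((k : ℚ) / ((2 * H + 1 : ℕ) : ℚ))
      - ∑ k ∈ Icc 1 H, (if p ∣ k then (0 : ℚ) else ratMinusSymbol f ((k : ℚ) / ((2 * H + 1 : ℕ) : ℚ))) = 2 * z * u := by
    refine exists_int_sum_sub_sum _ _ _ fun k hk => ?_
    rw [mem_Icc] at hk
    obtain ⟨z₀, hz₀⟩ := hu.2 ((k : ℚ) / ((2 * H + 1 : ℕ) : ℚ))
    by_cases hpk : p ∣ k
    · have hk0 : ¬ (k % p ∈ Icc 1 h) := by
        rw [Nat.mod_eq_zero_of_dvd hpk, mem_Icc]; omega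
      have hM0 : ¬ ((2 * H + 1 - k) % p ∈ Icc 1 h) := by
        rw [Nat.mod_eq_zero_of_dvd (Nat.dvd_sub hpM hpk), mem_Icc]; omega
      exact ⟨0, by rw [if_neg hk0, if_neg hM0, if_pos hpk]; push_cast; ring⟩
    · have hr0 : 0 < k % p := Nat.pos_of_ne_zero fun h0 => hpk (Nat.dvd_of_mod_eq_zero h0)
      have hrp : k % p < p := Nat.mod_lt k hp0
      have hmodM : (2 * H + 1 - k) % p = p - k % p := sub_mod_eq_of_dvd hp0 hpM (by omega) hpk
      by_cases hlow : k % p ≤ h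
      · have hwk : k % p ∈ Icc 1 h := by rw [mem_Icc]; omega
        have hwM : ¬ ((2 * H + 1 - k) % p ∈ Icc 1 h) := by rw [hmodM, mem_Icc]; omega
        exact ⟨0, by rw [if_pos hwk, if_neg hwM, if_neg hpk]; push_cast; ring⟩
      · have hwk : ¬ (k % p ∈ Icc 1 h) := by rw [mem_Icc]; omega
        have hwM : (2 * H + 1 - k) % p ∈ Icc 1 h := by rw [hmodM, mem_Icc]; omega
        exact ⟨-z₀, by rw [if_neg hwk, if_pos hwM, if_neg hpk, hz₀]; push_cast; ring⟩
  -- (iv) the `b`-sum is `F_M` minus the multiples of `p`, and those give `F_q`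
  have h5 : ∑ k ∈ Icc 1 H, (if p ∣ k then (0 : ℚ) else ratMinusSymbol f ((k : ℚ) / ((2 * H + 1 : ℕ) : ℚ))) =
      ∑ k ∈ (Icc 1 H).filter (fun k => ¬ p ∣ k), ratMinusSymbol f ((k : ℚ) / ((2 * H + 1 : ℕ) : ℚ)) := by
    rw [sum_filter]
    refine sum_congr rfl fun k hk => ?_
    split_ifs <;> simp_all
  have h6 : ∑ k ∈ (Icc 1 H).filter (fun k => ¬ p ∣ k), ratMinusSymbol f ((k : ℚ) / ((2 * H + 1 : ℕ) : ℚ)) =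
      ∑ k ∈ Icc 1 H, ratMinusSymbol f ((k : ℚ) / ((2 * H + 1 : ℕ) : ℚ))
        - ∑ k ∈ (Icc 1 H).filter (fun k => p ∣ k), ratMinusSymbol f ((k : ℚ) / ((2 * H + 1 : ℕ) : ℚ)) := by
    rw [eq_sub_iff_add_eq, add_comm, sum_filter_add_sum_filter_not]
  have hq0' : (q : ℚ) ≠ 0 := by rw [hq]; positivity
  have hp0' : (p : ℚ) ≠ 0 := by rw [hp]; positivity
  have h7 : ∑ i ∈ Icc 1 h', ratMinusSymbol f ((i : ℚ) / (q : ℚ)) =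
      ∑ k ∈ (Icc 1 H).filter (fun k => p ∣ k), ratMinusSymbol f ((k : ℚ) / ((2 * H + 1 : ℕ) : ℚ)) := by
    refine sum_nbij' (fun i => i * p) (fun k => k / p) ?_ ?_ ?_ ?_ ?_
    · intro i hi
      rw [mem_Icc] at hi
      rw [mem_filter, mem_Icc]
      have h1p : 1 * p ≤ i * p := Nat.mul_le_mul_right p hi.1
      have h2p : i * p ≤ h' * p := Nat.mul_le_mul_right p hi.2
      have h3p : h' * p = p * h' := Nat.mul_comm _ _
      exact ⟨⟨by omega, by omega⟩, Dvd.intro_left i rfl⟩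
    · intro k hk
      rw [mem_filter, mem_Icc] at hk
      obtain ⟨⟨hk1, hkH⟩, ⟨i, rfl⟩⟩ := hk
      rw [Nat.mul_div_cancel_left i hp0, mem_Icc]
      constructor
      · rcases Nat.eq_zero_or_pos i with rfl | hi0
        · simp at hk1
        · exact hi0
      · by_contra hle
        have h5 : p * (h' + 1) ≤ p * i := Nat.mul_le_mul_left p (by omega)
        have e : p * (h' + 1) = p * h' + p := by ring
        omega
    · intro i hi
      exact Nat.mul_div_cancel i hp0
    · intro k hk
      rw [mem_filter] at hk
      exact Nat.div_mul_cancel hk.2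
    · intro i hi
      congr 1
      rw [← hM]
      push_cast
      field_simp
      try ring
  obtain ⟨z, hz⟩ := h4
  refine ⟨z, ?_⟩
  rw [h1, h2, h3, h7]
  rw [h5, h6] at hz
  linarith

/-- Casting back the absolutely least residue: `|b·|a·k|| = k` for `b·a = 1` in `ZMod m`, `m = 2h+1`, `1 ≤ k ≤ h`. -/
theorem natAbs_valMinAbs_mul_cast_natAbs_valMinAbs_mul {m : ℕ} [NeZero m] (h : ℕ) (hmh : m = 2 * h + 1)
    (a b : ZMod m) (hba : b * a = 1) {k : ℕ} (hk : k ∈ Icc 1 h) :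
    (b * (((a * (k : ZMod m)).valMinAbs.natAbs : ℕ) : ZMod m)).valMinAbs.natAbs = k := by
  rw [mem_Icc] at hk
  have hkh : k ≤ m / 2 := by omega
  have hk' : ((k : ZMod m).valMinAbs.natAbs) = k := by
    rw [ZMod.valMinAbs_natCast_of_le_half hkh, Int.natAbs_natCast]
  rw [ZMod.natCast_natAbs_valMinAbs]
  split_ifs
  · rw [← mul_assoc, hba, one_mul, hk']
  · rw [mul_neg, ← mul_assoc, hba, one_mul, ZMod.natAbs_valMinAbs_neg, hk']

/-- The half-system permutation (Gauss-lemma style, any odd modulus): for `a` a unit of `ZMod m`, `m = 2h+1`,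
`k ↦ |a·k|` (absolutely least residue) permutes `[1, h]`. -/
theorem sum_Icc_natAbs_valMinAbs_mul_eq {m : ℕ} [NeZero m] (h : ℕ) (hmh : m = 2 * h + 1) (a b : ZMod m)
    (hab : a * b = 1) (g : ℕ → ℚ) :
    ∑ k ∈ Icc 1 h, g ((a * (k : ZMod m)).valMinAbs.natAbs) = ∑ k ∈ Icc 1 h, g k := by
  have hba : b * a = 1 := by rw [mul_comm]; exact hab
  have hmem : ∀ (c d : ZMod m), d * c = 1 → ∀ k ∈ Icc 1 h, (c * (k : ZMod m)).valMinAbs.natAbs ∈ Icc 1 h := by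
    intro c d hdc k hk
    rw [mem_Icc] at hk ⊢
    refine ⟨?_, ?_⟩
    · rw [Nat.one_le_iff_ne_zero, Ne, Int.natAbs_eq_zero, ZMod.valMinAbs_eq_zero]
      intro h0
      have hk0 : (k : ZMod m) = 0 := by
        have := congrArg (d * ·) h0
        simpa [← mul_assoc, hdc] using this
      rw [ZMod.natCast_eq_zero_iff] at hk0
      have := Nat.le_of_dvd (by omega) hk0
      omega
    · have := ZMod.natAbs_valMinAbs_le (c * (k : ZMod m))
      omega
  refine sum_nbij' (fun k : ℕ => (a * (k : ZMod m)).valMinAbs.natAbs) (fun k : ℕ => (b * (k : ZMod m)).valMinAbs.natAbs) (hmem a b hba)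
    (hmem b a hab) ?_ ?_ ?_
  · intro k hk; exact natAbs_valMinAbs_mul_cast_natAbs_valMinAbs_mul h hmh a b hba hk
  · intro k hk; exact natAbs_valMinAbs_mul_cast_natAbs_valMinAbs_mul h hmh b a hab hk
  · intro k hk; rfl

/-- LEMMA B: `∑_{k=1}^{h} [qk/m]⁻ ≡ F_m (mod 2u)` for `m = 2h+1` odd and `q` prime to `m` (half-system permutation). -/
theorem exists_int_sum_mul_div_eq {u : ℚ} (hu : IsMinusSymbolUnit f u) {m : ℕ} (h : ℕ) (hmh : m = 2 * h + 1)
    {q : ℕ} (hqm : Nat.Coprime q m) :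
    ∃ z : ℤ, ∑ k ∈ Icc 1 h, ratMinusSymbol f ((q : ℚ) * ((k : ℚ) / (m : ℚ))) =
      ∑ k ∈ Icc 1 h, ratMinusSymbol f ((k : ℚ) / (m : ℚ)) + 2 * z * u := by
  haveI : NeZero m := ⟨by omega⟩
  have hm' : (m : ℚ) ≠ 0 := by rw [hmh]; positivity
  have hab : (q : ZMod m) * (((ZMod.unitOfCoprime q hqm)⁻¹ : (ZMod m)ˣ) : ZMod m) = 1 := by
    rw [← ZMod.coe_unitOfCoprime q hqm]; exact (ZMod.unitOfCoprime q hqm).mul_inv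
  -- termwise: `[qk/m]⁻ ≡ [|v_k|/m]⁻ (mod 2u)` with `v_k` the absolutely least residue of `qk mod m`
  have ht : ∃ z : ℤ, ∑ k ∈ Icc 1 h, ratMinusSymbol f ((q : ℚ) * ((k : ℚ) / (m : ℚ)))
      - ∑ k ∈ Icc 1 h, ratMinusSymbol f (((((q : ZMod m) * k).valMinAbs.natAbs : ℕ) : ℚ) / (m : ℚ)) = 2 * z * u := by
    refine exists_int_sum_sub_sum _ _ _ fun k hk => ?_
    have hvz : ((((q : ZMod m) * k).valMinAbs : ℤ) : ZMod m) = (q : ZMod m) * k := ZMod.coe_valMinAbs _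
    have hdvd : (m : ℤ) ∣ (q : ℤ) * k - ((q : ZMod m) * k).valMinAbs := by
      rw [← ZMod.intCast_zmod_eq_zero_iff_dvd]
      push_cast
      simp
    obtain ⟨t, ht⟩ := hdvd
    have htQ : ((q : ℚ) * k - ((((q : ZMod m) * k).valMinAbs : ℤ) : ℚ)) = (m : ℚ) * (t : ℚ) := by
      exact_mod_cast ht
    have e1 : (q : ℚ) * ((k : ℚ) / (m : ℚ)) = ((((q : ZMod m) * k).valMinAbs : ℤ) : ℚ) / (m : ℚ) + ((t : ℤ) : ℚ) := by
      field_simp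
      linarith
    rw [e1, ratMinusSymbol_add_intCast]
    rcases Int.natAbs_eq (((q : ZMod m) * k).valMinAbs) with hc | hc
    · refine ⟨0, ?_⟩
      have : ((((q : ZMod m) * k).valMinAbs : ℤ) : ℚ) = ((((q : ZMod m) * k).valMinAbs.natAbs : ℕ) : ℚ) := by
        rw [hc]; simp
      rw [this]; simp
    · obtain ⟨z₀, hz₀⟩ := hu.2 (((((q : ZMod m) * k).valMinAbs.natAbs : ℕ) : ℚ) / (m : ℚ))
      refine ⟨-z₀, ?_⟩
      have : ((((q : ZMod m) * k).valMinAbs : ℤ) : ℚ) = -((((q : ZMod m) * k).valMinAbs.natAbs : ℕ) : ℚ) := by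
        rw [hc]; simp
      rw [this, neg_div, ratMinusSymbol_neg, hz₀]; push_cast; ring
  have hperm := sum_Icc_natAbs_valMinAbs_mul_eq h hmh (q : ZMod m) _ hab
    (fun n => ratMinusSymbol f ((n : ℚ) / (m : ℚ)))
  obtain ⟨z, hz⟩ := ht
  exact ⟨z, by rw [← hperm]; linarith⟩

/-- **AN-33b at every odd level (PROVED): the Hecke step `F_{qm} − (a_q − 1)·F_m − F_q ∈ 2uℤ`** for `m` odd, `q` an odd prime,
`q ∤ N`, `q ∤ m`. -/
theorem minusHalfSumHeckeStep (hf : IsNewform0 f) (hQ : coeffField f = ⊥) {u : ℚ} (hu : IsMinusSymbolUnit f u)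
    {m q : ℕ} (hmo : Odd m) (hq : q.Prime) (hqo : Odd q) (hqN : ¬ q ∣ N) (hqm : ¬ q ∣ m)
    {aq : ℤ} (haq : cuspCoeff f q = (aq : ℂ)) :
    ∃ z : ℤ, minusHalfSum f (q * m) - (aq - 1) * minusHalfSum f m - minusHalfSum f q = 2 * z * u := by
  obtain ⟨h, hmh⟩ := hmo
  obtain ⟨h', hqh'⟩ := hqo
  haveI : NeZero q := ⟨hq.ne_zero⟩
  have hcop : Nat.Coprime q m := (Nat.Prime.coprime_iff_not_dvd hq).2 hqm
  have hm0 : (m : ℚ) ≠ 0 := by rw [hmh]; positivity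
  have hq0 : (q : ℚ) ≠ 0 := by exact_mod_cast hq.ne_zero
  have hM : q * m = 2 * (2 * h * h' + h + h') + 1 := by rw [hmh, hqh']; ring
  have eP : minusHalfSum f m = ∑ k ∈ Icc 1 h, ratMinusSymbol f ((k : ℚ) / (m : ℚ)) := by
    unfold minusHalfSum; rw [show (m - 1) / 2 = h by omega]
  have eQ : minusHalfSum f q = ∑ k ∈ Icc 1 h', ratMinusSymbol f ((k : ℚ) / (q : ℚ)) := by
    unfold minusHalfSum; rw [show (q - 1) / 2 = h' by omega]
  have eM : minusHalfSum f (q * m) =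
      ∑ k ∈ Icc 1 (2 * h * h' + h + h'), ratMinusSymbol f ((k : ℚ) / ((2 * (2 * h * h' + h + h') + 1 : ℕ) : ℚ)) := by
    unfold minusHalfSum; rw [hM, show (2 * (2 * h * h' + h + h') + 1 - 1) / 2 = 2 * h * h' + h + h' by omega]
  -- the Hecke relation, summed over `k ∈ [1, h]`
  have hrat := ratCast_ratMinusSymbol f hf hQ
  have hHecke : ∀ r : ℚ, (aq : ℚ) * ratMinusSymbol f r =
      ∑ j : Fin q, ratMinusSymbol f ((r + j) / q) + ratMinusSymbol f (q * r) :=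
    intCast_mul_ratMinusSymbol q hf hq hqN haq hrat
  have hA : (aq : ℚ) * minusHalfSum f m =
      ∑ k ∈ Icc 1 h, ∑ j ∈ range q, ratMinusSymbol f (((k + j * m : ℕ) : ℚ) / ((2 * (2 * h * h' + h + h') + 1 : ℕ) : ℚ))
        + ∑ k ∈ Icc 1 h, ratMinusSymbol f ((q : ℚ) * ((k : ℚ) / (m : ℚ))) := by
    rw [eP, mul_sum, ← sum_add_distrib]
    refine sum_congr rfl fun k hk => ?_
    rw [hHecke]
    congr 1
    rw [show (∑ j : Fin q, ratMinusSymbol f ((((k : ℚ) / (m : ℚ)) + j) / q)) =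
        ∑ j ∈ range q, ratMinusSymbol f ((((k : ℚ) / (m : ℚ)) + j) / q) from
      Fin.sum_univ_eq_sum_range (fun j : ℕ => ratMinusSymbol f ((((k : ℚ) / (m : ℚ)) + j) / q)) q]
    refine sum_congr rfl fun j hj => ?_
    congr 1
    rw [← hM]
    push_cast
    field_simp
    try ring
  obtain ⟨z₁, hz₁⟩ := exists_int_doubleSum_eq_sub f hu m q (2 * h * h' + h + h') h h' hmh hqh' hM
  obtain ⟨z₂, hz₂⟩ := exists_int_sum_mul_div_eq f hu h hmh hcop
  refine ⟨-(z₁ + z₂), ?_⟩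
  rw [hz₁, hz₂, ← eM, ← eQ, ← eP] at hA
  push_cast
  linarith

/-- **AN-33b PROVED: `MinusHalfSumHeckeStepModTwo` holds.** -/
theorem minusHalfSumHeckeStepModTwo_holds : MinusHalfSumHeckeStepModTwo := by
  intro N _ f hf hQ u hu m q hmo hq hqo hqN hqm aq haq
  exact minusHalfSumHeckeStep f hf hQ hu hmo hq hqo hqN hqm haq

/-- **AN-33c PROVED: the minus half-sum proportionality law `a_{q'}·F_q − a_q·F_{q'} ∈ 2uℤ`.** -/
theorem minusHalfSumProportionalityModTwo_holds : MinusHalfSumProportionalityModTwo :=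
  minusHalfSumProportionalityModTwo_of_step minusHalfSumHeckeStepModTwo_holds

end HalfSumProofs

end Summit.BirchSwinnertonDyer.Rank1Residual.F1Sign2.ANg16

end
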